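import Mathlib
import HarnessLib
import Literature.Analysis.FluidPDE.KNSSSwirlSupNonpos
import Literature.Analysis.FluidPDE.KNSSLemma21Proof
import Summits.NavierStokesRegularity.NavierStokesRegularity.Theorems.HalfSpaceWindowDoorCirculationCarryingRigiditySourcedSwirl

/-!
# Route `HalfSpaceWindowDoor`, crux `CirculationCarryingRigidity` (stmt-NavierStokesRegularity-25311) — the SOURCED SWIRL
# LIOUVILLE TOOL, part 2: the Lemma 2.1 plateau and the slice / time identities

For a sourced swirl triple (`…Defs.IsSourcedSwirl`: KNSS's swirl pair plus an extra radial drift `β e_r`, `|β| r ≤ A`,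
`|β|√(τ−t) ≤ A`, `∂ᵣf ≥ 0`): (i) `exists_rescale_ge` — KNSS (5.14): if `sup f = M > 0`, then for every `L ≥ 1`, `T`, `ε > 0` a
rescaled copy is `≥ M − ε` on `{1 ≤ r ≤ 2, |z| ≤ L} × (1, T)`, by the tree's PROVED Lemma 2.1
(`Literature.Analysis.FluidPDE.KNSS2009_lemma21_holds`) applied with the merged drift `u + (2/r + β)e_r` (bounded by
`2C_u + 4 + 2A` off the axis, uniformly in the scaling); (ii) `slice_identity` (KNSS (5.17)/(5.19) on a slice; pure integration
by parts); (iii) `time_identity` (KNSS (5.15)/(5.17) on a line off the axis, with the SOURCED integrand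
`ΔF − DF[V] − (2/r + B)∂ᵣF`).  Proofs are the tree's (`KNSSSwirlSupNonpos`) with the extra drift carried along.

Seat ns-hsw-p1 g3 (LEAD of 25311, cell pub-ns-dss).  WHAT THIS IS NOT: not a statement about Navier–Stokes regularity; a linear
parabolic Liouville tool (KNSS 2009 Thm 5.3 with an extra radial drift); helper `--supports` 25311.
-/

noncomputable section

-- the summit and its single sub-problem share the name (CONVENTIONS §1), as in every Theorems file
set_option linter.dupNamespace false

namespace Summit.NavierStokesRegularity.NavierStokesRegularity.Theorems.HalfSpaceWindowDoorCirculationCarryingRigiditySourcedSwirlPlateau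

open MeasureTheory Set Function Filter Topology TopologicalSpace InnerProductSpace WithLp Metric
open scoped Laplacian RealInnerProductSpace ContDiff
open Literature.Analysis Literature.Analysis.FluidPDE
open Summit.NavierStokesRegularity.NavierStokesRegularity.Theorems.HalfSpaceWindowDoorCirculationCarryingRigidityDefs
open Summit.NavierStokesRegularity.NavierStokesRegularity.Theorems.HalfSpaceWindowDoorCirculationCarryingRigiditySourcedSwirl

open Summit.NavierStokesRegularity.NavierStokesRegularity.Theorems.HalfSpaceWindowDoorCirculationCarryingRigiditySourcedSwirl.IsSourcedSwirl

namespace IsSourcedSwirl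

variable {Cf Cu A : ℝ} {f : ℝ → (EuclideanSpace ℝ (Fin 3)) → ℝ} {u : ℝ → (EuclideanSpace ℝ (Fin 3)) → (EuclideanSpace ℝ (Fin 3))} {β : ℝ → (EuclideanSpace ℝ (Fin 3)) → ℝ}

/-! ### The Lemma 2.1 step: the rescaled scalar is `≥ M − ε` on a long annular cylinder -/

/-- **The Lemma 2.1 step** (tree `IsKNSSSwirlPair.exists_rescale_ge`, KNSS (5.14)): for a sourced swirl triple on `(−∞, 0)`
whose scalar has supremum `M > 0`, approached with near-maxima off the axis, and for `L ≥ 1`, `T`, `ε > 0`, there are `λ > 0`,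
`t* < 0`, `z̄` such that the rescaled scalar `f(t* + λ²(s − T), z̄e_z + λy)` is `≥ M − ε` for `s ∈ (1, T)`, `1 ≤ r(y) ≤ 2`,
`|y₂| ≤ L`.  Lemma 2.1 (`KNSS2009_lemma21_holds`) is applied on `{1/2 < r < 3, |z| < L+1}` with the merged drift
`u + (2/r + β)e_r`, bounded by `2C_u + 4 + 2A` there uniformly in the scaling. -/
theorem exists_rescale_ge (h : IsSourcedSwirl Cf Cu A 0 f u β) {M : ℝ} (hM : 0 < M) (hfM : ∀ t < 0, ∀ x, f t x ≤ M)
    (happr : ∀ η > 0, ∃ t < 0, ∃ x, M - η < f t x ∧ (η ≤ M → cylRadius x ≠ 0))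
    {L T ε : ℝ} (hL : 1 ≤ L) (hε : 0 < ε) :
    ∃ lam > 0, ∃ tstar < (0 : ℝ), ∃ zbar : ℝ,
      ∀ s ∈ Ioo 1 T, ∀ y ∈ annCylClosed 1 2 L,
        M - ε ≤ stPull (lam ^ 2) lam (tstar - lam ^ 2 * T) (zbar • eZ) f s y := by
  have hL21 : KNSS2009_lemma21 (EuclideanSpace ℝ (Fin 3)) := KNSS2009_lemma21_holds _
  have hCf := Cf_nonneg h
  have hCu := Cu_nonneg h
  have hA := h.A_nonneg
  set M' : ℝ := M + Cf with hM'
  have hM'pos : 0 < M' := by positivity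
  set Ω : Set (EuclideanSpace ℝ (Fin 3)) := annCyl (1 / 2) 3 (L + 1) with hΩ
  set Ω' : Set (EuclideanSpace ℝ (Fin 3)) := annCyl (3 / 4) (5 / 2) (L + 1 / 2) with hΩ'
  set K : Set (EuclideanSpace ℝ (Fin 3)) := annCylClosed 1 2 L with hK
  have hΩo : IsOpen Ω := isOpen_annCyl _ _ _
  have hΩb : Bornology.IsBounded Ω := isBounded_annCyl _ _ _
  have hΩc : IsConnected Ω := isConnected_annCyl (by norm_num) (by norm_num) (by linarith)
  have hcl : closure Ω' ⊆ Ω :=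
    (closure_annCyl_subset _ _ _).trans (annCylClosed_subset_annCyl (by norm_num) (by norm_num)
      (by linarith))
  have hKc : IsCompact K := isCompact_annCylClosed _ _ _
  have hKΩ : K ⊆ Ω := annCylClosed_subset_annCyl (by norm_num) (by norm_num) (by linarith)
  have hKΩ' : K ⊆ Ω' := annCylClosed_subset_annCyl (by norm_num) (by norm_num) (by linarith)
  have hΩr : ∀ y ∈ Ω, 1 / 2 < cylRadius y := fun y hy => cylRadius_gt_of_mem_annCyl le_rfl hy
  obtain ⟨δ, hδ, hP⟩ := hL21 (T := T) (A := 2 * Cu + 4 + 2 * A) hΩo hΩb hΩc hcl hKc hKΩ one_pos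
    (div_pos hε hM'pos : 0 < ε / M')
  set η : ℝ := min (M' * δ) (M / 2) with hη
  have hηpos : 0 < η := lt_min (by positivity) (by positivity)
  obtain ⟨tstar, htstar, xstar, hnear, hoff⟩ := happr η hηpos
  have hr : cylRadius xstar ≠ 0 := hoff ((min_le_right _ _).trans (by linarith))
  have hrpos : 0 < cylRadius xstar := lt_of_le_of_ne (cylRadius_nonneg _) (Ne.symm hr)
  set lam : ℝ := cylRadius xstar / (3 / 2) with hlam
  have hlampos : 0 < lam := by positivity
  set zbar : ℝ := xstar 2 with hzbar
  refine ⟨lam, hlampos, tstar, htstar, zbar, ?_⟩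
  have hresc := rescale h hlampos tstar zbar T
  set F := stPull (lam ^ 2) lam (tstar - lam ^ 2 * T) (zbar • eZ) f with hF
  have hτ' : T < T + (0 - tstar) / lam ^ 2 := by
    have : 0 < (0 - tstar) / lam ^ 2 := div_pos (by linarith) (by positivity)
    linarith
  obtain ⟨hb_meas, hb_bd, hg_C2, hg_cont1, hg_cont2, hg_eq⟩ := lemma21_data hresc hτ' Cf hΩr
  have htime : ∀ s, s ≤ T → tstar + lam ^ 2 * (s - T) < 0 := by
    intro s hs
    have : lam ^ 2 * (s - T) ≤ 0 := mul_nonpos_of_nonneg_of_nonpos (by positivity) (by linarith)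
    linarith
  have hFval : ∀ s y, F s y = f (tstar + lam ^ 2 * (s - T)) (zbar • eZ + lam • y) := fun s y =>
    stPull_rescale_apply lam tstar zbar T f s y
  have hg_bd : ∀ s ∈ Ioc 0 T, ∀ y ∈ Ω, |F s y + Cf| ≤ M' := by
    intro s hs y _
    rw [hFval]
    have h1 := hfM _ (htime s hs.2) (zbar • eZ + lam • y)
    have h2 := (_root_.abs_le.1 (h.abs_le _ (htime s hs.2) (zbar • eZ + lam • y))).1
    rw [_root_.abs_le]
    constructor <;> linarith
  set y₀ : (EuclideanSpace ℝ (Fin 3)) := lam⁻¹ • (xstar - zbar • eZ) with hy₀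
  have hy₀eq : zbar • eZ + lam • y₀ = xstar := by
    rw [hy₀, smul_smul, mul_inv_cancel₀ hlampos.ne', one_smul, add_sub_cancel]
  have hy₀r : cylRadius y₀ = 3 / 2 := by
    have h1 : cylRadius (zbar • eZ + lam • y₀) = lam * cylRadius y₀ := by
      rw [cylRadius_smul_eZ_add_smul, abs_of_pos hlampos]
    rw [hy₀eq] at h1
    have h2 : cylRadius xstar = lam * (3 / 2) := by rw [hlam]; ring
    have h3 : lam * cylRadius y₀ = lam * (3 / 2) := by rw [← h1, ← h2]
    exact mul_left_cancel₀ hlampos.ne' h3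
  have hy₀z : y₀ 2 = 0 := by
    simp [hy₀, hzbar, eZ]
  have hy₀K : y₀ ∈ K := by
    refine ⟨by rw [hy₀r]; norm_num, by rw [hy₀r]; norm_num, ?_⟩
    rw [hy₀z, abs_zero]; linarith
  have hnear' : ∃ x ∈ K, M' * (1 - δ) ≤ F T x + Cf := by
    refine ⟨y₀, hy₀K, ?_⟩
    rw [hF, stPull_rescale_apply_T, hy₀eq]
    have hηδ : η ≤ M' * δ := min_le_left _ _
    nlinarith
  have key := hP hb_meas hb_bd hg_C2 hg_cont1 hg_cont2 hg_eq hM'pos hg_bd hnear'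
  intro s hs y hy
  have := key s hs y (hKΩ' hy)
  have hcalc : M' * (1 - ε / M') = M' - ε := by field_simp
  rw [hcalc] at this
  linarith

/-! ### The integrated equation tested against the cut-off: slice and time identities -/

variable {τ' : ℝ} {F : ℝ → (EuclideanSpace ℝ (Fin 3)) → ℝ} {V : ℝ → (EuclideanSpace ℝ (Fin 3)) → (EuclideanSpace ℝ (Fin 3))} {B : ℝ → (EuclideanSpace ℝ (Fin 3)) → ℝ}

/-- **The slice identity** (tree `IsKNSSSwirlPair.slice_identity`; no equation involved — Green, the divergence-free IBP and
the axis integration by parts): `∫ (F − M)(Dφ[V] + Δφ) + ∫ (2/r) F Dφ[e_r] = ∫ (ΔF − DF[V] − (2/r)∂ᵣF) φ`. -/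
theorem slice_identity (hP : IsSourcedSwirl Cf Cu A τ' F V B) {s : ℝ} (hs : s < τ') (L T M : ℝ) :
    (∫ y, (F s y - M) * (fderiv ℝ (phiCut L T s) y (V s y) + (Δ (phiCut L T s)) y)) +
      ∫ y, 2 / cylRadius y * (F s y * fderiv ℝ (phiCut L T s) y (eR y)) =
    ∫ y, ((Δ (F s)) y - fderiv ℝ (F s) y (V s y) -
      2 / cylRadius y * partialDeriv (eR y) (F s) y) * phiCut L T s y := by
  set φ := phiCut L T s with hφ
  have hφs : ContDiff ℝ 2 φ := contDiff_phiCut L T s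
  have hφc : HasCompactSupport φ := hasCompactSupport_phiCut L T s
  have hF2 : ContDiff ℝ 2 (F s) := (hP.smooth s hs).of_le (by norm_cast)
  have hF1 : ContDiff ℝ 1 (F s) := (hP.smooth s hs).of_le (by norm_cast)
  have hV1 : ContDiff ℝ 1 (V s) := (hP.smooth_drift s hs).of_le (by norm_cast)
  have hcF : Continuous (F s) := hF1.continuous
  have hcFM : Continuous fun y => F s y - M := hcF.sub continuous_const
  have hcDφV : Continuous fun y => fderiv ℝ φ y (V s y) :=
    (hφs.continuous_fderiv (by norm_num)).clm_apply hV1.continuous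
  have hcΔφ : Continuous (Δ φ) := continuous_laplacian hφs
  have hcΔF : Continuous (Δ (F s)) := continuous_laplacian hF2
  have hcDFV : Continuous fun y => fderiv ℝ (F s) y (V s y) :=
    (hF1.continuous_fderiv one_ne_zero).clm_apply hV1.continuous
  have hcφ : Continuous φ := hφs.continuous
  have hi1 : Integrable fun y => (F s y - M) * fderiv ℝ φ y (V s y) :=
    (hcFM.mul hcDφV).integrable_of_hasCompactSupport
      (HasCompactSupport.fderiv_apply_fun hφc (V s)).mul_left
  have hi2 : Integrable fun y => (F s y - M) * (Δ φ) y :=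
    (hcFM.mul hcΔφ).integrable_of_hasCompactSupport (HasCompactSupport.laplacian_fun hφc).mul_left
  have hi3 : Integrable fun y => (Δ (F s)) y * φ y :=
    (hcΔF.mul hcφ).integrable_of_hasCompactSupport hφc.mul_left
  have hi4 : Integrable fun y => fderiv ℝ (F s) y (V s y) * φ y :=
    (hcDFV.mul hcφ).integrable_of_hasCompactSupport hφc.mul_left
  obtain ⟨hi5, hi6, haxis⟩ := integrable_and_integral_two_div_cylRadius_mul_fderiv_eR hF1
    (hφs.of_le (by norm_num)) hφc (hP.axisymmetric s hs) (isAxisymmetricScalar_phiCut L T s)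
    (hP.axis s hs)
  have hconv := integral_sub_const_mul_fderiv_apply_eq hV1 (hP.divFree s hs) hF1
    (hφs.of_le (by norm_num)) hφc M
  have hgreen := integral_sub_const_mul_laplacian_eq hF2 hφs hφc M
  have hL : ∫ y, (F s y - M) * (fderiv ℝ φ y (V s y) + (Δ φ) y) =
      (∫ y, (F s y - M) * fderiv ℝ φ y (V s y)) + ∫ y, (F s y - M) * (Δ φ) y := by
    rw [← integral_add hi1 hi2]
    exact integral_congr_ae (Eventually.of_forall fun y => by ring)
  have hi34 : Integrable fun y => (Δ (F s)) y * φ y - fderiv ℝ (F s) y (V s y) * φ y :=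
    hi3.sub hi4
  have hR : ∫ y, ((Δ (F s)) y - fderiv ℝ (F s) y (V s y) -
      2 / cylRadius y * partialDeriv (eR y) (F s) y) * φ y =
      (∫ y, (Δ (F s)) y * φ y) - (∫ y, fderiv ℝ (F s) y (V s y) * φ y) -
        ∫ y, 2 / cylRadius y * (fderiv ℝ (F s) y (eR y) * φ y) := by
    rw [← integral_sub hi3 hi4, ← integral_sub hi34 hi5]
    refine integral_congr_ae (Eventually.of_forall fun y => ?_)
    simp only [partialDeriv_apply]
    ring
  rw [hL, hR, hconv, hgreen, haxis]
  ring

/-- **The integrand of the time-integrated SOURCED swirl equation**,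
`G(s, y) = ΔF(s,·)(y) − DF(s,·)(y)[V(s,y)] − (2/r + B(s,y)) ∂ᵣF(s,·)(y)`. -/
theorem sourcedIntegrand_eq (F : ℝ → (EuclideanSpace ℝ (Fin 3)) → ℝ) (V : ℝ → (EuclideanSpace ℝ (Fin 3)) → (EuclideanSpace ℝ (Fin 3))) (B : ℝ → (EuclideanSpace ℝ (Fin 3)) → ℝ) (s : ℝ) (y : (EuclideanSpace ℝ (Fin 3))) :
    (Δ (F s)) y - fderiv ℝ (F s) y (V s y) - (2 / cylRadius y + B s y) * partialDeriv (eR y) (F s) y =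
      swirlEqnIntegrand F V s y - B s y * fderiv ℝ (F s) y (eR y) := by
  simp only [swirlEqnIntegrand, partialDeriv_apply]
  ring

/-- **The time identity on a line off the axis** (tree `IsKNSSSwirlPair.time_identity`, with the sourced integrand): for
`0 ≤ T < τ'`, `y` off the axis and any constant `M`,
`∫₀ᵀ (F(s,y) − M) ∂ₛφ(s,y) ds = −∫₀ᵀ (G₀(s,y) − B ∂ᵣF) φ(s,y) ds`, `G₀ = swirlEqnIntegrand F V`. -/
theorem time_identity (hP : IsSourcedSwirl Cf Cu A τ' F V B) {L T : ℝ} (hT0 : 0 ≤ T)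
    (hTτ : T < τ') (M : ℝ) {y : (EuclideanSpace ℝ (Fin 3))} (hy : cylRadius y ≠ 0) :
    ∫ s in (0 : ℝ)..T, (F s y - M) * (psiCut L y * deriv (zetaCut T) s) =
      -∫ s in (0 : ℝ)..T, (swirlEqnIntegrand F V s y - B s y * fderiv ℝ (F s) y (eR y)) * phiCut L T s y := by
  have hτ : ∀ s ∈ Icc (0 : ℝ) T, s < τ' := fun s hs => lt_of_le_of_lt hs.2 hTτ
  have hslab : MapsTo (fun s : ℝ => ((s, y) : ℝ × (EuclideanSpace ℝ (Fin 3)))) (Icc 0 T) (Iio τ' ×ˢ univ) :=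
    fun s hs => ⟨hτ s hs, mem_univ _⟩
  have hcs : Continuous fun s : ℝ => ((s, y) : ℝ × (EuclideanSpace ℝ (Fin 3))) := by fun_prop
  have hA' : ContinuousOn (fun s => (Δ (F s)) y) (Icc 0 T) := by
    have h := hP.continuousOn_laplacian.comp hcs.continuousOn hslab
    simpa only [Function.comp_def] using h
  have hBc : ContinuousOn (fun s => fderiv ℝ (F s) y) (Icc 0 T) := by
    have h := hP.continuousOn_fderiv.comp hcs.continuousOn hslab
    simpa only [Function.comp_def] using h
  have hVm : Measurable fun s => V s y := by
    have h : Measurable fun s : ℝ => ((s, y) : ℝ × (EuclideanSpace ℝ (Fin 3))) := measurable_id.prodMk measurable_const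
    exact hP.measurable_drift.comp h
  have hBm : Measurable fun s => B s y := by
    have h : Measurable fun s : ℝ => ((s, y) : ℝ × (EuclideanSpace ℝ (Fin 3))) := measurable_id.prodMk measurable_const
    exact hP.measurable_beta.comp h
  obtain ⟨KB, hKB⟩ := (isCompact_Icc (a := (0 : ℝ)) (b := T)).exists_bound_of_continuousOn hBc
  have hr : 0 < cylRadius y := lt_of_le_of_ne (cylRadius_nonneg y) (Ne.symm hy)
  have hGint : IntegrableOn (fun s => swirlEqnIntegrand F V s y - B s y * fderiv ℝ (F s) y (eR y))
      (Icc 0 T) := by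
    have hA2 : IntegrableOn (fun s => (Δ (F s)) y) (Icc 0 T) := hA'.integrableOn_compact isCompact_Icc
    have hD' : IntegrableOn (fun s => 2 / cylRadius y * fderiv ℝ (F s) y (eR y)) (Icc 0 T) :=
      ((hBc.clm_apply continuousOn_const).integrableOn_compact isCompact_Icc).const_mul _
    have hBV : IntegrableOn (fun s => fderiv ℝ (F s) y (V s y)) (Icc 0 T) := by
      have hmeas : AEStronglyMeasurable (fun s => fderiv ℝ (F s) y (V s y))
          (volume.restrict (Icc 0 T)) := by
        have h1 : AEStronglyMeasurable (fun s => fderiv ℝ (F s) y) (volume.restrict (Icc 0 T)) :=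
          hBc.aestronglyMeasurable measurableSet_Icc
        have h2 : AEStronglyMeasurable (fun s => V s y) (volume.restrict (Icc 0 T)) :=
          hVm.aestronglyMeasurable
        exact (isBoundedBilinearMap_apply (𝕜 := ℝ) (E := (EuclideanSpace ℝ (Fin 3))) (F := ℝ)).continuous.comp_aestronglyMeasurable
          (h1.prodMk h2)
      refine Integrable.mono' (integrableOn_const (C := KB * (Cu / cylRadius y))
        (by exact measure_Icc_lt_top.ne)) hmeas ?_
      rw [ae_restrict_iff' measurableSet_Icc]
      refine Eventually.of_forall fun s hs => ?_
      have hV : ‖V s y‖ ≤ Cu / cylRadius y := by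
        rw [le_div_iff₀ hr, mul_comm]; exact hP.drift_le s (hτ s hs) y
      rw [Real.norm_eq_abs, ← Real.norm_eq_abs]
      exact ((fderiv ℝ (F s) y).le_opNorm _).trans (mul_le_mul (hKB s hs) hV (norm_nonneg _)
        ((norm_nonneg _).trans (hKB s hs)))
    have hBF : IntegrableOn (fun s => B s y * fderiv ℝ (F s) y (eR y)) (Icc 0 T) := by
      have hmeas : AEStronglyMeasurable (fun s => B s y * fderiv ℝ (F s) y (eR y))
          (volume.restrict (Icc 0 T)) :=
        hBm.aestronglyMeasurable.mul ((hBc.clm_apply continuousOn_const).aestronglyMeasurable measurableSet_Icc)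
      refine Integrable.mono' (integrableOn_const (C := A / cylRadius y * KB)
        (by exact measure_Icc_lt_top.ne)) hmeas ?_
      rw [ae_restrict_iff' measurableSet_Icc]
      refine Eventually.of_forall fun s hs => ?_
      have hb : |B s y| ≤ A / cylRadius y := by
        rw [le_div_iff₀ hr]; exact hP.beta_le_radial s (hτ s hs) y
      have hD : |fderiv ℝ (F s) y (eR y)| ≤ KB := by
        rw [← Real.norm_eq_abs]
        exact ((fderiv ℝ (F s) y).le_opNorm _).trans
          ((mul_le_of_le_one_right (norm_nonneg _) (norm_eR_le_one _)).trans (hKB s hs))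
      rw [Real.norm_eq_abs, abs_mul]
      exact mul_le_mul hb hD (abs_nonneg _) (div_nonneg hP.A_nonneg hr.le)
    have : IntegrableOn (fun s => (Δ (F s)) y - fderiv ℝ (F s) y (V s y) -
        2 / cylRadius y * fderiv ℝ (F s) y (eR y) - B s y * fderiv ℝ (F s) y (eR y)) (Icc 0 T) :=
      ((hA2.sub hBV).sub hD').sub hBF
    simpa only [swirlEqnIntegrand, partialDeriv_apply] using this
  have hg : IntervalIntegrable (fun s => swirlEqnIntegrand F V s y - B s y * fderiv ℝ (F s) y (eR y))
      volume 0 T :=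
    (intervalIntegrable_iff_integrableOn_Ioc_of_le hT0).2 (hGint.mono_set Ioc_subset_Icc_self)
  have hΦ : ∀ s ∈ Icc (0 : ℝ) T, F s y = F 0 y +
      ∫ r in (0 : ℝ)..s, (swirlEqnIntegrand F V r y - B r y * fderiv ℝ (F r) y (eR y)) := by
    intro s hs
    have h := hP.eqn y hy 0 s hs.1 (hτ s hs)
    have e : (fun r => (Δ (F r)) y - fderiv ℝ (F r) y (V r y) -
        (2 / cylRadius y + B r y) * partialDeriv (eR y) (F r) y) =
        fun r => swirlEqnIntegrand F V r y - B r y * fderiv ℝ (F r) y (eR y) :=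
      funext fun r => sourcedIntegrand_eq F V B r y
    rw [e] at h
    linarith
  have hψ : ContDiff ℝ 1 fun s => phiCut L T s y :=
    show ContDiff ℝ 1 (fun s => psiCut L y * zetaCut T s) from contDiff_const.mul (contDiff_zetaCut T)
  have hψ0 : phiCut L T 0 y = 0 :=
    phiCut_eq_zero_of_not_mem_Ioo (fun h => by linarith [h.1]) y
  have hψT : phiCut L T T y = 0 :=
    phiCut_eq_zero_of_not_mem_Ioo (fun h => lt_irrefl _ h.2) y
  have key := integral_sub_const_mul_deriv_eq_neg (Φ := fun s => F s y)
    (g := fun s => swirlEqnIntegrand F V s y - B s y * fderiv ℝ (F s) y (eR y))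
    (ψ := fun s => phiCut L T s y) hT0 hg hΦ hψ hψ0 hψT M
  rw [← key]
  refine intervalIntegral.integral_congr fun s _ => ?_
  simp only [(hasDerivAt_phiCut L T s y).deriv]

end IsSourcedSwirl

end Summit.NavierStokesRegularity.NavierStokesRegularity.Theorems.HalfSpaceWindowDoorCirculationCarryingRigiditySourcedSwirlPlateau

end
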